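import Mathlib.LinearAlgebra.Matrix.Block
import Mathlib.LinearAlgebra.Matrix.Determinant.Basic
import Mathlib.RingTheory.Polynomial.Basic
import Mathlib.LinearAlgebra.Matrix.Rank
import Literature.NumberTheory.Transcendental.KZCalculus
import Literature.NumberTheory.Transcendental.KZSemialgebraicComplex
import HarnessLib

/-!
# Feynman-graph periods for the KZ calculus: Kirchhoff polynomial, parametric representation

Topic `MathematicalPhysics/QuantumFieldTheory` (definition request `defn-graphPeriodRep` of route
`KontsevichZagierPeriods/PhiFourLaboratory`, whose ten items inline the formulas below and are to
be restated over them). Sources read: F. Brown, *On the periods of some Feynman integrals*,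
arXiv:0910.0114 [Brown2009FeynmanPeriods] — §1.1 Def. 4 ("`G` is primitive divergent if
`e_G = 2h_G`, and for all strict subgraphs `γ ⊊ G`, `e_γ > 2 h_γ`"), §2.1 Def. 13 (`Ψ_G = Σ_T Π_{e∉T}
α_e`, sum over spanning trees; `Ψ_G = 0` if `G` is not connected), §2.2 Def. 19 (the graph
matrix `M_G = [[diag α, ℰ_G], [-ℰ_Gᵀ, 0]]`, `ℰ_G` the incidence matrix `ε_{e,v} = 1` if `s(e) = v`,
`-1` if `t(e) = v`, with one column deleted), Lemma 20 (Kirchhoff) and Prop. 21 ("If `G` is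
connected, then `Ψ_G = det M_G`. If `G` is not connected, then `Ψ_G = det M_G = 0`"), §3.1
(`I_G = ∫_Δ Ω_G/Ψ_G²` "is (absolutely) convergent, and defines a positive real number" for `G`
primitive divergent, after [BEK]); S. Bloch, H. Esnault, D. Kreimer, *On motives associated to graph
polynomials*, CMP 267 (2006) = arXiv:math/0510011 [BlochEsnaultKreimer2006] — Prop. 2.2 (2.4)
matrix-tree, Prop. 5.2 (convergence iff primitive log divergent); O. Schnetz, *Quantum periods*,
CNTP 4 (2010) = arXiv:0801.2856 [Schnetz2010] — Def.-Thm. 1 (primitive), Def.-Thm. 7 (six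
equivalent forms; (6d) affine position space, (6e) parametric `P_Γ = ∫_Δ Ω(α)/Ψ_{Γ-∞}(α)²`,
`Δ = {α_i > 0}`, read in the affine chart `α_N = 1` as p. 5 recommends).

## Contents (namespace `Literature.MathematicalPhysics.QuantumFieldTheory`)

Graphs are **edge lists** `E : Fin N → Fin (V+1) × Fin (V+1)` (multigraphs with `N` oriented edges
`e : s(e) = (E e).1 → t(e) = (E e).2` on `V + 1` vertices; vertex `0` is the deleted root), the
encoding of the route items.

* `reducedIncidence R E : Matrix (Fin N) (Fin V) R` — Brown's `ℰ_G` (column of vertex `0` deleted):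
  entry `(if s(e) = j+1 then 1 else 0) - (if t(e) = j+1 then 1 else 0)`.
* `graphMatrix E x` — Brown's `M_G` `[[diag x, ℰ], [-ℰᵀ, 0]]` at edge weights `x : Fin N → R`;
  `kirchhoffEval E x := det (graphMatrix E x)` — the **Kirchhoff (first Symanzik) polynomial
  evaluated at `x`** (`= Ψ_G(x)` by Prop. 21 / matrix-tree); `kirchhoffPolynomial R E :
  MvPolynomial (Fin N) R` (the same determinant with `x = X`), `aeval_kirchhoffPolynomial`
  (evaluation commutes with the determinant, PROVED); `dualKirchhoffEval` (`Ψ̄(x) = (Π x) Ψ(1/x)`,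
  Schnetz (6f)); `affineKirchhoffPolynomial` (`x_N := 1`) with `aeval_affineKirchhoffPolynomial`.
* `edgeRank`, `loopNumber` (`h₁(γ) = |γ| - rk ℰ_γ`), `IsConnectedEdgeList` (`rk ℰ = V`),
  `IsPrimitiveDivergent` (Brown Def. 4 / Schnetz Def. 1), `IsPhiFour` (all degrees `≤ 4`).
* `openOrthant n` (PROVED semialgebraic), `graphPeriodIntegrand E x = 1 / Ψ_E(x, 1)²` — literally
  the inlined integrand of the route — and **`graphPeriodRep E h0 hint : KZ.IntegralRep n`**, the
  parametric representation `∫_{x > 0} dx / Ψ_E(x,1)²` (Schnetz (6e), affine chart), packaged with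
  its two analytic inputs as hypotheses (`Ψ ≠ 0` on the orthant; absolute convergence), with
  `isRational_graphPeriodRep` (KZ-literal shape `1/q`) PROVED.
* ONE named fact `graphPeriod_convergent_of_isPrimitiveDivergent` (Brown §3.1 after BEK Prop. 5.2
  and Lemma 6.1; Schnetz Def.-Thm. 7): for a connected primitive-divergent edge list, `Ψ(x,1) > 0`
  on the open orthant and the parametric integral converges absolutely; and the convenience
  constructor `graphPeriodRepOfPrimitive` taking that fact as an explicit hypothesis.
* `positionIntegrand` — the affine position-space integrand `Π_e 1/|y_{s(e)} - y_{t(e)}|²` with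
  vertex `0 ↦ 0 ∈ ℝ⁴`, vertex `1 ↦ e₁`, vertex `j+2 ↦ y_j` (Schnetz (6d)), as inlined in item
  `PositionIsParametric`.

Deliberately NOT here (follow-ups): the matrix-tree theorem `det M_G = Σ_T Π_{e∉T} x_e` (Brown
Prop. 21, BEK Prop. 2.2 — provable from Cauchy–Binet and Kirchhoff's Lemma 20; not needed by the
route, which works with the determinant), the converse "convergent ⇒ primitive", the `π^{2(ℓ-1)}`
comparison of (6d) with (6e), completed (4-regular) graphs and completion invariance (Schnetz
Prop. 6, Def.-Thm. 7 step six; Broadhurst–Kreimer 1995), the Hepp bound. Mathlib/tree: no graph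
polynomial / Kirchhoff / Symanzik / spanning-tree enumeration for multigraph edge lists
(`lean search 'kirchhoff|Symanzik|spanningTree'`: nothing); Mathlib's `SimpleGraph` has no
multi-edges and is not the encoding of the route.

## References

* [Brown2009FeynmanPeriods] F. Brown, arXiv:0910.0114, Def. 4, Def. 13, Def. 19, Lemma 20,
  Prop. 21, §3.1.
* [BlochEsnaultKreimer2006] S. Bloch, H. Esnault, D. Kreimer, CMP 267 (2006), Prop. 2.2, Prop. 5.2,
  Lemma 6.1.
* [Schnetz2010] O. Schnetz, CNTP 4 (2010), Def.-Thm. 1, Prop. 6, Def.-Thm. 7 (6d), (6e), (6f).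
-/

noncomputable section

open MvPolynomial Set MeasureTheory
open scoped BigOperators Matrix

namespace Literature.MathematicalPhysics.QuantumFieldTheory

/-! ### The graph matrix and the Kirchhoff polynomial -/

section Kirchhoff

variable (R : Type*) [CommRing R] {N V : ℕ}

/-- Brown's **reduced incidence matrix** `ℰ_G` of the edge list `E` (edges `e : s(e) → t(e)`,
`s(e) = (E e).1`, `t(e) = (E e).2`, on the vertices `Fin (V+1)`), with the column of the root
vertex `0` deleted: `ℰ_{e,j} = ε_{e,j+1}`, `ε_{e,v} = 1` if `s(e) = v`, `-1` if `t(e) = v`, `0`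
otherwise (both if `e` is a tadpole at `v`) (Brown 2009, §2.2). [cite: Brown2009FeynmanPeriods, §2.2 (ε_{e,v} and ℰ_G)] -/
def reducedIncidence (E : Fin N → Fin (V + 1) × Fin (V + 1)) : Matrix (Fin N) (Fin V) R :=
  Matrix.of fun e j =>
    (if (E e).1 = j.succ then (1 : R) else 0) - (if (E e).2 = j.succ then (1 : R) else 0)

variable {R}

/-- Entries of the reduced incidence matrix (definitional). [folklore] -/
theorem reducedIncidence_apply (E : Fin N → Fin (V + 1) × Fin (V + 1)) (e : Fin N) (j : Fin V) :
    reducedIncidence R E e j =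
      (if (E e).1 = j.succ then (1 : R) else 0) - (if (E e).2 = j.succ then (1 : R) else 0) := rfl

/-- Brown's **graph matrix** `M_G = [[diag x, ℰ_G], [-ℰ_Gᵀ, 0]]` at edge weights `x`
(Brown 2009, Def. 19; the block matrix inlined by route `PhiFourLaboratory`). [cite: Brown2009FeynmanPeriods, Def. 19] -/
def graphMatrix (E : Fin N → Fin (V + 1) × Fin (V + 1)) (x : Fin N → R) :
    Matrix (Fin N ⊕ Fin V) (Fin N ⊕ Fin V) R :=
  Matrix.fromBlocks (Matrix.diagonal x) (reducedIncidence R E) (-(reducedIncidence R E).transpose)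
    (0 : Matrix (Fin V) (Fin V) R)

/-- The **Kirchhoff (first Symanzik, graph) polynomial evaluated at edge weights `x`**:
`Ψ_E(x) := det M_G(x)` (Brown 2009, Prop. 21: for connected `G` this determinant is the graph
polynomial `Σ_{T spanning tree} Π_{e ∉ T} x_e` of Def. 13, and it is `0` for disconnected `G`;
BEK 2006, Prop. 2.2). [cite: Brown2009FeynmanPeriods, Prop. 21 (Ψ_G = det M_G) and Def. 13] -/
def kirchhoffEval (E : Fin N → Fin (V + 1) × Fin (V + 1)) (x : Fin N → R) : R :=
  (graphMatrix E x).det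

/-- Unfolding `kirchhoffEval` to the literal block determinant of the route items. [folklore] -/
theorem kirchhoffEval_eq_det (E : Fin N → Fin (V + 1) × Fin (V + 1)) (x : Fin N → R) :
    kirchhoffEval E x =
      (Matrix.fromBlocks (Matrix.diagonal x)
        (Matrix.of fun (e : Fin N) (j : Fin V) =>
          (if (E e).1 = j.succ then (1 : R) else 0) - (if (E e).2 = j.succ then (1 : R) else 0))
        (-(Matrix.of fun (e : Fin N) (j : Fin V) =>
          (if (E e).1 = j.succ then (1 : R) else 0) - (if (E e).2 = j.succ then (1 : R) else 0)).transpose)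
        (0 : Matrix (Fin V) (Fin V) R)).det := rfl

variable (R)

/-- The **Kirchhoff polynomial** `Ψ_E ∈ R[x_e : e ∈ E]` as a formal polynomial: the graph-matrix
determinant with the variables `X e` as edge weights (Brown 2009, Def. 13 with Prop. 21). [cite: Brown2009FeynmanPeriods, Def. 13 and Prop. 21] -/
def kirchhoffPolynomial (E : Fin N → Fin (V + 1) × Fin (V + 1)) : MvPolynomial (Fin N) R :=
  kirchhoffEval E (MvPolynomial.X : Fin N → MvPolynomial (Fin N) R)

variable {R}

/-- **Evaluation commutes with the Kirchhoff determinant**: for every ring homomorphism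
`f : R →+* S`, `f (Ψ_E(x)) = Ψ_E(f ∘ x)` (`RingHom.map_det`, blockwise). [folklore] -/
theorem map_kirchhoffEval {S : Type*} [CommRing S] (f : R →+* S)
    (E : Fin N → Fin (V + 1) × Fin (V + 1)) (x : Fin N → R) :
    f (kirchhoffEval E x) = kirchhoffEval E (f ∘ x) := by
  rw [kirchhoffEval, kirchhoffEval, RingHom.map_det, RingHom.mapMatrix_apply]
  congr 1
  ext i k
  rcases i with e | j <;> rcases k with e' | j'
  · simp only [graphMatrix, Matrix.map_apply, Matrix.fromBlocks_apply₁₁, Matrix.diagonal_apply,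
      Function.comp_apply]
    split_ifs <;> simp
  · simp [graphMatrix, reducedIncidence, apply_ite f]
  · simp [graphMatrix, reducedIncidence, apply_ite f]
  · simp [graphMatrix]

/-- The Kirchhoff polynomial evaluates to the Kirchhoff determinant: `Ψ_E(x) = aeval x Ψ_E` for
edge weights in any `R`-algebra. [folklore] -/
theorem aeval_kirchhoffPolynomial {A : Type*} [CommRing A] [Algebra R A]
    (E : Fin N → Fin (V + 1) × Fin (V + 1)) (x : Fin N → A) :
    aeval x (kirchhoffPolynomial R E) = kirchhoffEval E x := by
  rw [kirchhoffPolynomial, show (aeval x : MvPolynomial (Fin N) R →ₐ[R] A) (kirchhoffEval E X) =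
      (aeval x : MvPolynomial (Fin N) R →ₐ[R] A).toRingHom (kirchhoffEval E X) from rfl,
    map_kirchhoffEval]
  congr 1
  funext e
  simp

/-- The **dual Kirchhoff polynomial evaluated at `x`**: `Ψ̄_E(x) = (Π_e x_e) · Ψ_E(1/x)` (over a
field; `= Σ_T Π_{e ∈ T} x_e`, Schnetz 2010 (6f) "dual parametric"; BEK). [cite: Schnetz2010, Def.-Thm. 7 (6f)] -/
def dualKirchhoffEval {K : Type*} [Field K] (E : Fin N → Fin (V + 1) × Fin (V + 1))
    (x : Fin N → K) : K :=
  (∏ e, x e) * kirchhoffEval E (fun e => (x e)⁻¹)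

end Kirchhoff

/-! ### Loop numbers, connectedness, primitive divergence, `φ⁴` -/

section Combinatorics

variable {N V : ℕ}

/-- The rank of the (reduced) incidence rows of the edge subset `γ` (over `ℚ`): the rank of the
graphic matroid on `γ`, `= |V(γ)| - #components(γ)` counting only vertices met by `γ`
together with the root component. [folklore] -/
def edgeRank (E : Fin N → Fin (V + 1) × Fin (V + 1)) (γ : Finset (Fin N)) : ℕ :=
  (Matrix.of fun (p : {e // e ∈ γ}) (j : Fin V) => reducedIncidence ℚ E p.1 j).rank

/-- The **loop number** `h₁(γ) = |γ| - rk ℰ_γ` of the subgraph spanned by the edge subset `γ`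
(Euler's formula `h_G - h₀(G) = e_G - v_G`, Brown 2009 §1.1; the rank form used by the route). [cite: Brown2009FeynmanPeriods, §1.1 (Euler's formula)] -/
def loopNumber (E : Fin N → Fin (V + 1) × Fin (V + 1)) (γ : Finset (Fin N)) : ℕ :=
  γ.card - edgeRank E γ

/-- The edge list is **connected** (as a graph on all `V + 1` vertices): its reduced incidence
matrix has full column rank `V`. [folklore] -/
def IsConnectedEdgeList (E : Fin N → Fin (V + 1) × Fin (V + 1)) : Prop :=
  (reducedIncidence ℚ E).rank = V

/-- **Primitive (log-)divergent** (Brown 2009, Def. 4; Schnetz 2010, Def.-Thm. 1: "`Γ` is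
primitive if it has `n(Γ) = 2h₁(Γ)` edges and every proper subgraph `γ < Γ` has
`n(γ) > 2h₁(γ)`"; subgraphs = edge subsets, Brown §1.1; the EMPTY edge set is excluded — for it
`e_γ = 2h_γ = 0`, and the printed condition is meant for non-empty proper subgraphs, being
automatic for non-empty forests). [cite: Brown2009FeynmanPeriods, Def. 4] -/
def IsPrimitiveDivergent (E : Fin N → Fin (V + 1) × Fin (V + 1)) : Prop :=
  N = 2 * loopNumber E Finset.univ ∧
    ∀ γ : Finset (Fin N), γ.Nonempty → γ ≠ Finset.univ → 2 * loopNumber E γ < γ.card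

/-- The **degree** (valency) of the vertex `v` in the edge list `E`: the number of edges incident to
`v` (Brown 2009, §1.1; a tadpole at `v` is counted once, as in the route's inlined predicate). [cite: Brown2009FeynmanPeriods, §1.1] -/
def edgeDegree (E : Fin N → Fin (V + 1) × Fin (V + 1)) (v : Fin (V + 1)) : ℕ :=
  (Finset.univ.filter fun e => (E e).1 = v ∨ (E e).2 = v).card

/-- **`φ⁴` graph**: every vertex has degree at most `4` (Brown 2009, §1.1: "`G` is said to be in
`φ⁴` if every vertex has degree at most 4"). [cite: Brown2009FeynmanPeriods, §1.1] -/
def IsPhiFour (E : Fin N → Fin (V + 1) × Fin (V + 1)) : Prop :=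
  ∀ v, edgeDegree E v ≤ 4

/-- Unfolding `IsPhiFour` to the inlined predicate of the route items. [folklore] -/
theorem isPhiFour_iff (E : Fin N → Fin (V + 1) × Fin (V + 1)) :
    IsPhiFour E ↔ ∀ v, (Finset.univ.filter fun e => (E e).1 = v ∨ (E e).2 = v).card ≤ 4 :=
  Iff.rfl

end Combinatorics

/-! ### The parametric integral representation `∫_{x>0} dx / Ψ_E(x, 1)²` -/

section Parametric

variable {n V : ℕ}

/-- The **open positive orthant** `{x ∈ ℝⁿ | ∀ j, 0 < x_j}` (the affine chart `x_N = 1` of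
Schnetz's `Δ = {α_i > 0}`). [cite: Schnetz2010, Def.-Thm. 7 (6e) (Δ = {α_i > 0})] -/
def openOrthant (n : ℕ) : Set (Fin n → ℝ) := {x | ∀ j, 0 < x j}

/-- Membership in the open orthant (definitional). [folklore] -/
theorem mem_openOrthant_iff {x : Fin n → ℝ} : x ∈ openOrthant n ↔ ∀ j, 0 < x j := Iff.rfl

/-- The open orthant is `ℚ`-semialgebraic (finite intersection of the positivity sets of the
coordinate polynomials). [folklore] -/
theorem isSemialgebraic_openOrthant (n : ℕ) :
    Literature.ModelTheory.ExponentialFields.IsSemialgebraic ℚ (openOrthant n) := by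
  classical
  have h : openOrthant n =
      ⋂ j ∈ (Finset.univ : Finset (Fin n)), {x : Fin n → ℝ | 0 < aeval x (X j : MvPolynomial (Fin n) ℚ)} := by
    ext x
    simp [openOrthant]
  rw [h]
  exact Literature.ModelTheory.ExponentialFields.IsSemialgebraic.biInter _ _ fun j _ =>
    Literature.ModelTheory.ExponentialFields.isSemialgebraic_setOf_eval_pos _

/-- The **parametric period integrand** in the affine chart `x_{last} = 1`:
`x ↦ 1 / Ψ_E(x₀, …, x_{n-1}, 1)²` for an edge list with `n + 1` edges (Schnetz 2010 (6e); junk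
value `1/0 = 0` where `Ψ` vanishes). Literally the integrand inlined by route `PhiFourLaboratory`. [cite: Schnetz2010, Def.-Thm. 7 (6e)] -/
def graphPeriodIntegrand (E : Fin (n + 1) → Fin (V + 1) × Fin (V + 1)) (x : Fin n → ℝ) : ℝ :=
  1 / (kirchhoffEval E (Fin.snoc x (1 : ℝ) : Fin (n + 1) → ℝ)) ^ 2

/-- Unfolding the integrand to the route's inline formula (definitional). [folklore] -/
theorem graphPeriodIntegrand_eq (E : Fin (n + 1) → Fin (V + 1) × Fin (V + 1)) (x : Fin n → ℝ) :
    graphPeriodIntegrand E x =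
      1 / ((Matrix.fromBlocks (Matrix.diagonal (Fin.snoc x (1 : ℝ) : Fin (n + 1) → ℝ))
        (Matrix.of fun (e : Fin (n + 1)) (j : Fin V) =>
          (if (E e).1 = j.succ then (1 : ℝ) else 0) - (if (E e).2 = j.succ then (1 : ℝ) else 0))
        (-(Matrix.of fun (e : Fin (n + 1)) (j : Fin V) =>
          (if (E e).1 = j.succ then (1 : ℝ) else 0) - (if (E e).2 = j.succ then (1 : ℝ) else 0)).transpose)
        (0 : Matrix (Fin V) (Fin V) ℝ)).det) ^ 2 := rfl

/-- The **affine Kirchhoff polynomial** `Ψ_E(x₀, …, x_{n-1}, 1) ∈ ℚ[x₀, …, x_{n-1}]`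
(the last edge weight set to `1`). [cite: Schnetz2010, Def.-Thm. 7 (6e)] -/
def affineKirchhoffPolynomial (E : Fin (n + 1) → Fin (V + 1) × Fin (V + 1)) :
    MvPolynomial (Fin n) ℚ :=
  bind₁ (Fin.snoc (fun i => X i) 1 : Fin (n + 1) → MvPolynomial (Fin n) ℚ) (kirchhoffPolynomial ℚ E)

/-- Evaluating the affine Kirchhoff polynomial at `x` gives `Ψ_E(x, 1)`. [folklore] -/
theorem aeval_affineKirchhoffPolynomial (E : Fin (n + 1) → Fin (V + 1) × Fin (V + 1))
    (x : Fin n → ℝ) :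
    aeval x (affineKirchhoffPolynomial E) = kirchhoffEval E (Fin.snoc x (1 : ℝ) : Fin (n + 1) → ℝ) := by
  rw [affineKirchhoffPolynomial, ← AlgHom.comp_apply, aeval_comp_bind₁, aeval_kirchhoffPolynomial]
  congr 1
  funext i
  refine Fin.lastCases ?_ (fun j => ?_) i
  · simp
  · simp

/-- **The parametric representation of a graph period** (Schnetz 2010, Def.-Thm. 7 (6e), read in
the affine chart `α_N = 1`; Brown 2009 §3.1; BEK 2006): `∫_{x ∈ (0,∞)ⁿ} dx / Ψ_E(x, 1)²` for an
edge list `E` with `n + 1` edges, as a `KZ.IntegralRep n`. Its two analytic inputs are hypotheses: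
`Ψ_E(x,1) ≠ 0` on the open orthant (true for connected `E`: `Ψ` is a non-empty sum of monomials
with coefficient `+1`, Brown Def. 13 / Prop. 21) and absolute convergence (true iff `E` is
primitive divergent, BEK Prop. 5.2 with Lemma 6.1; see the named fact
`graphPeriod_convergent_of_isPrimitiveDivergent`). Semialgebraicity of the integrand is PROVED
(`1 / q`, `q = Ψ(x,1)²` a `ℚ`-polynomial). [cite: Schnetz2010, Def.-Thm. 7 (6e)] -/
def graphPeriodRep (E : Fin (n + 1) → Fin (V + 1) × Fin (V + 1))
    (h0 : ∀ x ∈ openOrthant n, kirchhoffEval E (Fin.snoc x (1 : ℝ) : Fin (n + 1) → ℝ) ≠ 0)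
    (hint : IntegrableOn (graphPeriodIntegrand E) (openOrthant n)) :
    Literature.NumberTheory.Transcendental.KZ.IntegralRep n where
  domain := openOrthant n
  integrand := graphPeriodIntegrand E
  isSemialgebraic_domain := isSemialgebraic_openOrthant n
  isSemialgebraicFunOn_integrand := by
    have hq : ∀ x ∈ openOrthant n, aeval x (affineKirchhoffPolynomial E ^ 2) ≠ 0 := by
      intro x hx
      rw [map_pow, aeval_affineKirchhoffPolynomial]
      exact pow_ne_zero 2 (h0 x hx)
    refine (Literature.NumberTheory.Transcendental.isSemialgebraicFunOn_aeval_div_aeval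
      (isSemialgebraic_openOrthant n) (1 : MvPolynomial (Fin n) ℚ)
      (affineKirchhoffPolynomial E ^ 2) hq).congr fun x _ => ?_
    simp only [graphPeriodIntegrand, map_one, map_pow, aeval_affineKirchhoffPolynomial]
  integrableOn := hint

/-- The domain of `graphPeriodRep` is the open orthant (definitional). [folklore] -/
@[simp] theorem domain_graphPeriodRep (E : Fin (n + 1) → Fin (V + 1) × Fin (V + 1))
    (h0 : ∀ x ∈ openOrthant n, kirchhoffEval E (Fin.snoc x (1 : ℝ) : Fin (n + 1) → ℝ) ≠ 0)
    (hint : IntegrableOn (graphPeriodIntegrand E) (openOrthant n)) :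
    (graphPeriodRep E h0 hint).domain = openOrthant n := rfl

/-- The integrand of `graphPeriodRep` is `1 / Ψ_E(x,1)²` (definitional). [folklore] -/
@[simp] theorem integrand_graphPeriodRep (E : Fin (n + 1) → Fin (V + 1) × Fin (V + 1))
    (h0 : ∀ x ∈ openOrthant n, kirchhoffEval E (Fin.snoc x (1 : ℝ) : Fin (n + 1) → ℝ) ≠ 0)
    (hint : IntegrableOn (graphPeriodIntegrand E) (openOrthant n)) :
    (graphPeriodRep E h0 hint).integrand = graphPeriodIntegrand E := rfl

/-- The value of `graphPeriodRep` is the parametric integral `∫_{x>0} dx / Ψ_E(x,1)²`. [cite: Schnetz2010, Def.-Thm. 7 (6e)] -/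
theorem value_graphPeriodRep (E : Fin (n + 1) → Fin (V + 1) × Fin (V + 1))
    (h0 : ∀ x ∈ openOrthant n, kirchhoffEval E (Fin.snoc x (1 : ℝ) : Fin (n + 1) → ℝ) ≠ 0)
    (hint : IntegrableOn (graphPeriodIntegrand E) (openOrthant n)) :
    (graphPeriodRep E h0 hint).value = ∫ x in openOrthant n, graphPeriodIntegrand E x := rfl

/-- `graphPeriodRep` has KZ's literal (rational) shape: integrand `1 / q` with
`q = Ψ_E(x,1)² ∈ ℚ[x]` non-vanishing on the domain. [cite: KontsevichZagier2001, §1.1 (Definition)] -/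
theorem isRational_graphPeriodRep (E : Fin (n + 1) → Fin (V + 1) × Fin (V + 1))
    (h0 : ∀ x ∈ openOrthant n, kirchhoffEval E (Fin.snoc x (1 : ℝ) : Fin (n + 1) → ℝ) ≠ 0)
    (hint : IntegrableOn (graphPeriodIntegrand E) (openOrthant n)) :
    (graphPeriodRep E h0 hint).IsRational := by
  refine ⟨1, affineKirchhoffPolynomial E ^ 2, fun x hx => ?_, fun x _ => ?_⟩
  · rw [map_pow, aeval_affineKirchhoffPolynomial]
    exact pow_ne_zero 2 (h0 x hx)
  · simp [graphPeriodRep, graphPeriodIntegrand, aeval_affineKirchhoffPolynomial]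

/-- **Convergence and positivity for primitive-divergent graphs** (named fact). For a connected,
primitive-divergent edge list `E` with `n + 1` edges (Brown 2009, Def. 4), the Kirchhoff polynomial
is positive on the open orthant, `Ψ_E(x, 1) > 0` for all `x ∈ (0,∞)ⁿ` (Brown Def. 13 with
Prop. 21: `Ψ_G = det M_G` is a non-empty sum of monomials with coefficient `+1` for connected
`G`), and the parametric integral `∫_{x>0} dx/Ψ_E(x,1)²` converges absolutely (Brown 2009, §3.1:
`I_G = ∫_Δ Ω_G/Ψ_G²` "is (absolutely) convergent, and defines a positive real number", after
Bloch–Esnault–Kreimer 2006, Prop. 5.2 and Lemma 6.1; Schnetz 2010, Def.-Thm. 7: (6e) is well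
defined iff the graph is primitive). Stated in the affine chart `x_N = 1` of the projective
simplex. [cite: Brown2009FeynmanPeriods, §3.1 (convergence of I_G for primitive divergent G) with Def. 4, Def. 13, Prop. 21] -/
def graphPeriod_convergent_of_isPrimitiveDivergent : Prop :=
  ∀ {n V : ℕ} (E : Fin (n + 1) → Fin (V + 1) × Fin (V + 1)),
    IsConnectedEdgeList E → IsPrimitiveDivergent E →
      (∀ x ∈ openOrthant n, 0 < kirchhoffEval E (Fin.snoc x (1 : ℝ) : Fin (n + 1) → ℝ)) ∧
        IntegrableOn (graphPeriodIntegrand E) (openOrthant n)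

/-- **The graph period representation of a connected primitive-divergent graph**, from the
convergence fact `graphPeriod_convergent_of_isPrimitiveDivergent` taken as an explicit hypothesis
`h` (Schnetz 2010 (6e); the `φ⁴`-period when moreover `IsPhiFour E`). [cite: Schnetz2010, Def.-Thm. 7 (6e)] -/
def graphPeriodRepOfPrimitive (h : graphPeriod_convergent_of_isPrimitiveDivergent)
    (E : Fin (n + 1) → Fin (V + 1) × Fin (V + 1)) (hc : IsConnectedEdgeList E)
    (hp : IsPrimitiveDivergent E) : Literature.NumberTheory.Transcendental.KZ.IntegralRep n :=
  graphPeriodRep E (fun x hx => ((h E hc hp).1 x hx).ne') (h E hc hp).2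

end Parametric

/-! ### The affine position-space integrand (Schnetz (6d)) -/

section Position

variable {N k : ℕ}

/-- The point configuration of the affine position-space rules for a graph on the vertices
`Fin (k + 2)`: vertex `0 ↦ 0 ∈ ℝ⁴`, vertex `1 ↦ e₁ = (1,0,0,0)` ("`1`"), vertex `j + 2 ↦ y_j`,
where `y : Fin (k * 4) → ℝ` lists the free coordinates (`y_j = (y (4j), …, y (4j+3))`, via
`finProdFinEquiv`) (Schnetz 2010, Def.-Thm. 7 (6d): "set `x_0 = 0`, and set the position vector
`x_1` to any unit-vector `1`"). [cite: Schnetz2010, Def.-Thm. 7 (6d)] -/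
def positionPoints (k : ℕ) (y : Fin (k * 4) → ℝ) : Fin (k + 2) → Fin 4 → ℝ :=
  Fin.cons (0 : Fin 4 → ℝ)
    (Fin.cons (fun i : Fin 4 => if i = 0 then (1 : ℝ) else 0)
      (fun (j : Fin k) (i : Fin 4) => y (finProdFinEquiv (j, i))))

/-- The **affine position-space integrand** `Π_e 1/|x_{s(e)} - x_{t(e)}|²` of an edge list on
`Fin (k + 2)` (the vertex `∞` already removed), at the configuration `positionPoints`
(Schnetz 2010, Def.-Thm. 7 (6d); the value of `∫_{ℝ^{4k}}` is `π^{2k} P_Γ` for the completion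
`Γ`; junk `1/0 = 0` on the diagonals, a null set). Literally the integrand inlined by item
`PositionIsParametric`. [cite: Schnetz2010, Def.-Thm. 7 (6d)] -/
def positionIntegrand (E : Fin N → Fin (k + 2) × Fin (k + 2)) (y : Fin (k * 4) → ℝ) : ℝ :=
  ∏ e : Fin N, 1 / (∑ i : Fin 4, (positionPoints k y (E e).1 i - positionPoints k y (E e).2 i) ^ 2)

/-- Unfolding `positionIntegrand` to the route's inline formula (definitional). [folklore] -/
theorem positionIntegrand_eq (E : Fin N → Fin (k + 2) × Fin (k + 2)) (y : Fin (k * 4) → ℝ) :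
    positionIntegrand E y = ∏ e : Fin N, 1 / (∑ i : Fin 4,
      ((Fin.cons (0 : Fin 4 → ℝ) (Fin.cons (fun i : Fin 4 => if i = 0 then (1:ℝ) else 0)
          (fun (j : Fin k) (i : Fin 4) => y (finProdFinEquiv (j, i)))) : Fin (k+2) → Fin 4 → ℝ)
          (E e).1 i -
        (Fin.cons (0 : Fin 4 → ℝ) (Fin.cons (fun i : Fin 4 => if i = 0 then (1:ℝ) else 0)
          (fun (j : Fin k) (i : Fin 4) => y (finProdFinEquiv (j, i)))) : Fin (k+2) → Fin 4 → ℝ)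
          (E e).2 i) ^ 2) := rfl

end Position

end Literature.MathematicalPhysics.QuantumFieldTheory
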